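import Literature.NumberTheory.Automorphic.ShimuraCurveTakahashiCoordinateInputs
import Literature.NumberTheory.Automorphic.BrandtEichlerLevelUOperators
import HarnessLib

/-!
# The character group `X_p(J₀^D(M))`, `p ∣ D`, inside the Brandt module of type `(pM, D/p)`:
# Ribet's exact sequence ∕ Takahashi's discriminant-side dictionary, the new-projector
# (Jacquet–Langlands with strong multiplicity one) and «optimal degree ∣ congruence»
# (Papikian–Rabinoff) — ONE named fact over the tree's Brandt vocabulary

Topic `NumberTheory/Automorphic`. One named fact (`def … : Prop`, D-0014: results IN PRINT, cited at
the page, not proved here), no theorem, no instance, nothing restated. It is the DISCRIMINANT-SIDE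
(`p ∣ D`) companion of the tree's `D = 1` named fact
`Literature.NumberTheory.EllipticCurves.takahashi2001_characterGroupDictionary`
(`EllipticCurves/TakahashiDegreeFormulaFromDictionary.lean`) and, conjunct for conjunct, the
hypothesis `hDictDisc` of the tree's PROOF file
`ShimuraCurveRibetTakahashiBrandtDictionaryProofs.lean` (§II there; a proofs-only companion may not
declare a named fact, D-0026, which is why that package has so far been carried as a hypothesis) —
WITHOUT its multiplicity-one conjunct (`finrank … = 1`, which the tree derives from the named fact
`takahashi2001_thm_2_3_shimura_disc` of `ShimuraCurveTakahashiCoordinateInputs.lean`: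
`0 < ξ_S(a(W'))` by `takahashi2001_thm_2_3_shimura_disc.xi_pos`, and `ξ_S` is the junk value `0`
unless the eigen-lattice is a line, `Brandt.xi_of_not_isLine`) and WITH three further printed
clauses on the same sublattice `Y`: (deg⁰) `Y` lies in the degree-zero lattice; (C2′) the
new-projector `u_Y ∈ 𝕋_{pM,d}(S)`, `u_Y|_Y = N₀ ≠ 0`, `u_Y (ℤ[Cls O]⁰) ⊆ Y`; (C5′) «the optimal
degree divides the congruence number»: an element of `𝕋_{pM,d}(S)` which acts on `Y` as
`(a/δ)·q^* q_*` has `δ ∣ a`. Consumers: the registered skeletons of cruxes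
stmt-BirchSwinnertonDyer-26022 ∕ 26024 (`Summits/BirchSwinnertonDyer`, route `RamifiedHeegnerPair`,
lines `partnerdescent` v12 ∕ `splitkolyvagin0` v25), whose print stub DICT♭
`LeafHeckeDictionaryReducedAtThree` is this fact with three leaf-side hypotheses added (`3 ∤ N`,
`ρ̄_{W,3}` irreducible, `W` split multiplicative at `d`) which no source uses; the Summit-side
one-line instantiation is `Summit.…Theorems.LeafPartnerOrders.leafHeckeDictionaryReduced_of_print`.

**Honesty.** Nothing here proves a statement of `Summits/BirchSwinnertonDyer`: the consumers become
conditional on the fact below AS TYPED, by name. The statement is an AI-typed rendering of printed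
theorems; it is established only to the extent recorded in the docstring (source, locator, printed
scope), and the Lean kernel checks only the consumers' glue. BSD is proved for no curve by this file.

## Sources, as printed (READ at the page in the held texts; Ribet 1990 is not held — acq-09883 —
## and is cited through Takahashi 2001 p. 82 and Helm 2007 Thm. 5.4)

* [Takahashi2001] S. Takahashi, J. Number Theory 90 (2001) 74–88 (held, `doi:10.1006/jnth.2000.2614`).
  §2 p. 77–78 (`N` square-free, `N = DM`, `J = J₀^D(M)`, optimal quotient `π : J → E`, `δ = π ∘ π^∨ ∈ ℤ`,
  `c_r = #Φ_r(E)`, `L_r(J) = {x ∈ X_r(J) : T_n x = a_n(f) x for all n prime to N}`): "The map `π : J → E`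
  induces by pullback an injective map `π^* : X_r(E) ↪ X_r(J)`. The image of `π^*` lies in `L_r(J)`,
  since `T_n` acts on `X_r(E)` as multiplication by `a_n(f)`. The dual of `π` similarly induces a
  homomorphism `π_* : X_r(J) → X_r(E)`. Because of the assumption that `π : J → E` is an optimal quotient,
  the map `π^∨ : E → J` is injective. One deduces from this the surjectivity of the map `π_*`. The two
  homomorphisms are adjoint with respect to the monodromy pairings: `u_J(π^* x, y) = u_E(x, π_* y)` …
  This follows from the description of monodromy pairings in [SGA 7 IX]." P. 80: "The results stated
  so far are true for any prime `r` dividing `N`." P. 82: "**Proposition 3.1.** There is a canonical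
  exact sequence `0 → X_p(J′) →^∂ X_q(J) → X_q(J″) × X_q(J″) → 0`, where `J″ = J₀^d(qm)`" (`N = dpqm`,
  `J = J₀^d(pqm)`, `J′ = J₀^{dpq}(m)`) "The sequence is compatible with the action of Hecke operators
  `T_n` for `n` prime to `N` … Moreover, the map `∂` is compatible with the monodromy pairings on
  `X_p(J′)` and `X_q(J)` in the sense that `u_{J′}(x, y) = u_J(∂x, ∂y)` … When `D = 1`, the proposition
  was proved in [Ribet 1990] (see especially Theorem 4.1.) The case `D > 1` can be handled in an
  analogous way, using Buzzard's analogue of the Deligne–Rapoport theorem"; proof of Thm. 3.2: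
  "First recognize `∂ L_p(J′) ⊂ L_q(J)`, since the eigenvalues for both eigenspaces are the Fourier
  coefficients of `f` and `X_q(J″) × X_q(J″)` is torsion free." P. 84, proof of Thm. 3.8: "By Theorem
  4.7 in [Buzzard 1997], `X_r(J₀^{(d/r)}(rm))` is canonically isomorphic to the group of degree-`0`
  divisors on the set of isomorphism classes of locally free rank-`1` right modules over the Eichler
  order of level `m` in the definite quaternion algebra of discriminant `d`. The isomorphism is
  compatible with the action of Hecke operators `T_n`, for `n` prime to `N` as well as with the
  monodromy pairings" (`ω(d)` odd, `r ∣ d`).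
* [Helm2007] D. Helm, Israel J. Math. 160 (2007) = arXiv:math/0401265 (held). P. 1 and §5 p. 13
  (setting): "Fix a squarefree integer `N`, with an even number of prime divisors, and let `Γ` be a
  congruence subgroup of level `M` for some integer prime to `N`" — the cofactor level `M` is
  ARBITRARY — "`𝕋^R` denote the subalgebra of `End(J^{1,R})` generated by the Hecke operators `T_l` for
  `l` prime, (when `l` divides `MN` we take `T_l` to be defined as in [Ribet 1990]) … `𝕋` … acts
  simultaneously on all the `J^D`"; p. 13: "`J^{1,R}` (and hence every variety in `𝒜^R`) has purely
  toric reduction at any prime `p` dividing `R` … there are isomorphisms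
  `X_p(J^{D,R}) ⊗ ℚ ≅ 𝕋^R ⊗ ℚ`"; **Cor. 5.3** "`X_p(J^{D,R′}) ≅ X_p(J^{D,R}) ⊗_{𝕋^R} 𝕋^{R′}`";
  **Thm. 5.4** "There is a `𝕋^D`-equivariant exact sequence
  `0 → X_q(J^{Dpq,Dpq}) → X_p(J^{D,D}) → X_p(J^D(Γ₀(N/Dq) ∩ Γ))² → 0`. When `D = 1`, this is [Ribet 1990],
  Theorem 4.1. The same argument extends to the case where `D > 1` using Buzzard's analogue of the
  Deligne–Rapoport theorem, except that Buzzard's result assumes that the level structure is contained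
  in `Γ₁(r)` for some integer `r > 4`. An argument that removes this restriction can be found in the
  appendix."
* [PapikianRabinoff2016] M. Papikian, J. Rabinoff, Canad. J. Math. 68 (2016) = arXiv:1212.3574 (held),
  §3 (`J` the Jacobian of a curve with split degenerate reduction over a local field `K`, `Λ` the
  character group of the torus uniformising `J`, `π : J → E` an optimal quotient onto an elliptic
  curve): **¶23** "The endomorphism `e₀ = π^∨ ∘ π : J → J` corresponds to an idempotent
  `e ∈ End⁰(J) := End(J) ⊗_ℤ ℚ` … We denote by `n` the denominator of `e` in `End(J)`, i.e., the least
  natural number such that `ne ∈ End(J)` … `End(J)` is naturally a subring of `End(Λ)`";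
  **Lemma 24** "The morphism `π ∘ π^∨ : E → E` is the multiplication-by-`n` map on `E`. Proof. See the
  proof of Theorem 3 in [Zagier 1985]"; ¶25 "`e₀ = ne`"; ¶37–38: applied to `π : J₀^D(M) → E` over `ℚ`,
  `p ∣ D` (Čerednik–Drinfeld), after an unramified quadratic twist (Pasten 2024, proof of Lemma 6.18).
* [Buzzard1997] K. Buzzard, Duke Math. J. 87 (1997), Thm. 4.7 (v) (held): the fibre at `l` of
  `X^D(U, Γ₀(l))` is two copies of `X^D(U)_{𝔽_l}` crossing at the supersingular points, for ANY level
  structure `U` away from `l·D` (smallness removed in [Helm2007, appendix]).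
* [RibetTakahashi1997] PNAS 94, Prop. 1 (= the exact sequence, `N` square-free) — read on the open text.
* [JacquetLanglands1970], [AtkinLehner1970]: the Brandt module of type `(pM, d)` tensored with `ℂ` is,
  as a module over the anemic Hecke algebra, the space of weight-`2` forms of level `dpM` that are new
  at the primes of `d` (Eichler–Jacquet–Langlands; tree named facts `jacquetLanglands_global`,
  `jacquetLanglands_newform_of_brandtEigenformLite`), and two newforms with the same eigenvalues
  `a_ℓ` for all `ℓ ∤ dpM` coincide (strong multiplicity one), so that NO system of `T_ℓ`-eigenvalues
  (`ℓ ∤ dpM`) occurs both in the `p`-new part `Y ⊗ ℚ̄` and in the `p`-old quotient `(ℤ[Cls O]⁰/Y) ⊗ ℚ̄`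
  — Helm's form: Cor. 5.3 with `X_p ⊗ ℚ ≅ 𝕋 ⊗ ℚ` (the new quotient `𝕋^{Dpq} ⊗ ℚ` of `𝕋^D ⊗ ℚ` is a
  direct factor, cut out by an idempotent of the ANEMIC subalgebra).

## Rendering (the tree's idiom — module docstring of `ShimuraCurveTakahashiCoordinateInputs.lean`)

As there: `N = DM` admissible (`IsAdmissibleFactorization`), `D = p·d`, `X₀^D(M) = X : ShimuraCurveData D M`,
the class = any model `W` of conductor `N`, the optimal quotient `A_{D,M}` and `δ_{D,M}` = the curve
`W'` and the degree `P.deg` of a CLASS-MINIMAL datum `P : ShimuraParametrizationData X W'`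
(`P.IsMinimalFor W`; `p ∣ D` is a prime of multiplicative reduction, so the class is not CM and `W'`
is a `ℚ`-model of `A_{D,M}`), `c_p(A_{D,M}) = (W'.minimalDiscriminantNorm ℤ).factorization p` (Tate),
`a_n = W'.LFunction n`. The Brandt module is `ℤ^{Cls O}` of ANY setup `S : Brandt.XiSetup (p*M) d`
(Eichler order of level `pM` in the definite algebra of discriminant `d`; Takahashi p. 84 with
`(d, r, m) ↦ (d, s, pM)` for a prime `s ∣ d`: `ℤ[Cls O]⁰ = X_s(J₀^{d/s}(spM))`, Gross's pairing
`⟨e_c, e_c'⟩ = w_c δ_{cc'}` = the monodromy pairing, `T(ℓ) = Brandt.matrix S.O ℓ`), and Takahashi's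
Prop. 3.1 ∕ Helm's Thm. 5.4 with `(d, p, q, m) ↦ (d/s, p, s, M)` puts `Y := ∂ X_p(J₀^D(M))` inside
it: a sublattice with torsion-free cokernel (SATURATED), inside the degree-zero lattice (deg⁰), on
which Gross's pairing restricts to `u_{J₀^D(M)}`; `pb = ∂ ∘ q^* : ℤ = X_p(A) → Y` and
`pf = q_* ∘ ∂⁻¹ : Y → ℤ` are ADJOINT with the constant `u_A(1,1) = c_p(A)`; `pf ∘ pb = δ`
(`q ∘ q^∨ = [δ]`, Lemma 24); `pf` is ONTO (optimality); `pb 1 ∈` the `a(W')`-eigen-lattice of the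
`T(ℓ)`, `ℓ ∤ pMd` (`Brandt.eigenLattice (p*M*d) (Brandt.matrix S.O) a`; "the image of `π^*` lies in
`L_p`" and `∂ L_p(J′) ⊂ L_q(J)`). The full Hecke algebra `𝕋_{pM,d}(S) = S.fullHeckeAlgebra`
(`BrandtEichlerLevelUOperators.lean`: `T(ℓ)` at `ℓ ∤ pM`, the ideal-theoretic `U_ℓ` at `ℓ ∣ pM`,
W. Zhang 2014 §3.9) acts on `Y` through `End(J₀^D(M))` (Helm: `𝕋^D`-equivariance of the sequence,
`T_l` at `l ∣ MN` as in Ribet 1990 §3), and `End(J₀^D(M)) ⊆ End(Y)` (¶23). So: (C2′) the idempotent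
of `𝕋 ⊗ ℚ` cutting out the `p`-new factor, cleared of denominators, is `u_Y ∈ 𝕋_{pM,d}(S)` with
`u_Y|_Y = N₀ ≠ 0` and `u_Y(ℤ[Cls O]⁰) ⊆ Y ⊗ ℚ ∩ ℤ^{Cls O} = Y` (saturation); (C5′) if `C ∈ 𝕋_{pM,d}(S)`
acts on `Y` as `δ·C = a·(pb ∘ pf)`, i.e. `C = a·e` in `End(Y) ⊇ End(J)`, then `a·e ∈ End(J)`, and the
integers `a` with `a·e ∈ End(J)` form the ideal generated by the denominator `n = δ` (¶23, Lemma 24):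
`δ ∣ a`.

## Printed scope, and what is asserted beyond it (read this before citing)

Takahashi's and Ribet–Takahashi's standing hypothesis is `N` square-free; the fact below is stated for
EVERY admissible `N = DM`, `D = pd`, i.e. with an ARBITRARY cofactor `M` prime to `D` — the generality
of Helm 2007 (`N_Helm := D` square-free, `Γ := Γ₀(M)`, `M` any integer prime to `D`; Thm. 5.4 with the
appendix, Cor. 5.3, `X_p ⊗ ℚ ≅ 𝕋 ⊗ ℚ`), of Ribet 1990 Thm. 4.1 (`D = pq`, arbitrary level prime to
`pq`, as cited by both held sources), of Papikian–Rabinoff ¶23–¶25 (any `J₀^D(M)`, ¶37) and of the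
tree's sibling facts `takahashi2001_thm_2_3_shimura_disc` ∕ `PastenShimura2024_lemma_6_18_cokernelOrder_dvd`
(same binders; their module docstring § "Printed scope"). The pairing-compatibility of `∂` and of
Buzzard's identification at a non-square-free cofactor is ASSERTED as in those siblings (Takahashi
Prop. 3.1 and p. 84 state it for square-free `N`; the `D = 1` case at every cofactor is Ribet 1990 §§3–4;
Helm Thm. 5.4 records `𝕋`-equivariance at every cofactor). The clause (C2′) is the projector form of
Jacquet–Langlands + strong multiplicity one (Helm Cor. 5.3); (C5′) is ¶23 + Lemma 24 of
Papikian–Rabinoff read for `C` in the image of `𝕋_{pM,d}(S) → End(J₀^D(M))`. NOT asserted (and not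
used by the consumers): the multiplicity-one conjunct `rank L_p = 1` (derived in the tree, see above),
the Hecke-stability of `Y` (a theorem of saturation + (C2′) in the tree,
`Summit.…LeafPartnerOrders.heckeAt_mulVec_mem_of_projector`), Takahashi's Thm. 2.4 («`j_p = 1`», whose
proof has the gap recorded by Papikian–Rabinoff §4 and Pasten 2024 p. 24). None of the clauses is
provable in the tree (no Néron model, character group or monodromy pairing of a Jacobian; no
Čerednik–Drinfeld ∕ Deligne–Rapoport–Buzzard model; no Jacquet–Langlands transfer as a theorem).

## Mathlib / tree search

`lean search characterGroupDictionary` (tree: the `D = 1` fact and `hDictDisc`, cited above — not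
restated: this is the `p ∣ D` case, a different theorem, and `hDictDisc` is a hypothesis of a proofs
file), `newSubmodule` ∕ `degeneracyPush` (`BrandtEichlerLevelUOperators.lean`: definitions only, no
theorem identifying them with `Y`), `exists_heckeProjector` (`BrandtHeckeProjector.lean`: the projector
onto ONE eigen-line, a theorem — not the `p`-new projector), `NeronModel` ∕ `monodromy` (none for
Jacobians). Typed by the lead prover of crux 26022 (bsd-line-rhp-p2 g67) at the INPUTS desk's target
T-90a″ (`run/shared/lean/pub/bsd-wall/bsd-inputs/INPUT-T89-G3flatC-coordinates-inventory-g31.md`, rows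
(D), (C2′-b), (C5′)).
-/

noncomputable section

open scoped Matrix

namespace Literature.NumberTheory.Automorphic

/-- **The character group `X_p(J₀^D(M))`, `p ∣ D`, in the Brandt module of type `(pM, D/p)` with its
Hecke structure** (Takahashi 2001 Prop. 3.1 = Ribet's exact sequence, Thm. 3.2 (a) and p. 84; Helm 2007
Thm. 5.4 ∕ Cor. 5.3 at an arbitrary cofactor; Papikian–Rabinoff 2016 ¶23 + Lemma 24). For `N = DM`
admissible, `D = p·d`, `W/ℚ` of conductor `N`, `P` a class-minimal Shimura datum of `W` on
`X : ShimuraCurveData D M` (curve `W' ≅ A_{D,M}`, `P.deg = δ_{D,M}`) and EVERY Brandt setup `S` of type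
`(pM, d)`: inside `ℤ^{Cls O}` there are a sublattice `Y` (`= ∂ X_p(J₀^D(M))`), `ℤ`-linear
`pb : ℤ → Y` (`q^*`), `pf : Y → ℤ` (`q_*`), a matrix `u_Y` and `N₀ ∈ ℤ` such that:
(adj) `Σ_k w_k (pb a)_k y_k = c_p(A_{D,M}) · a · pf y` with `c_p = ord_p Δ_min(W')` (Grothendieck's
pairings, SGA 7 IX 11.5, and the adjunction of `q^*`, `q_*`); (δ) `pf (pb a) = P.deg · a`
(`q ∘ q^∨ = [δ]`); (opt) `pf` is onto (optimality); (sat) `Y` is saturated (`∂` has torsion-free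
cokernel); (eig) `pb 1` lies in the `a(W')`-eigen-lattice of the Brandt matrices `T(ℓ)`, `ℓ ∤ pMd`;
(deg⁰) every `y ∈ Y` has `Σ_c y_c = 0` (`Y ⊆ X_s(J₀^{d/s}(spM)) = ℤ[Cls O]⁰`); (C2′) `u_Y` lies in the
full Hecke algebra `𝕋_{pM,d}(S)` (`S.fullHeckeAlgebra`), `N₀ ≠ 0`, `u_Y y = N₀ y` on `Y` and `u_Y b ∈ Y`
for every degree-zero `b` (the `p`-new projector: Jacquet–Langlands + strong multiplicity one);
(C5′) for `C ∈ 𝕋_{pM,d}(S)` and `a ∈ ℤ` with `δ · (C y) = a · pf(y) · pb 1` on `Y`: `δ ∣ a` (the optimal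
degree `δ = n` is the denominator of `e = e₀/n` in `End(J) ⊆ End(Y)`). Printed scope: module docstring.
Not provable in the tree; users take `(h : shimuraCurve_characterGroupHeckeDictionary_disc)`.
[cite: Takahashi2001, §2 p. 78, Prop. 3.1 and Thm. 3.2 (a) (p. 82), proof of Thm. 3.8 (p. 84)]
[cite: Helm2007, Thm. 5.4, Cor. 5.3, §5 p. 13, appendix] [cite: Ribet1990, Prop. 3.1, Thm. 4.1]
[cite: PapikianRabinoff2016, §3 ¶23, Lemma 24, ¶25, ¶37] [cite: Buzzard1997, Thm. 4.7 (v)]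
[cite: RibetTakahashi1997, Prop. 1] [cite: JacquetLanglands1970, Thm. 14.4 and §16]
[cite: AtkinLehner1970, Thm. 5] [cite: WZhang2014, §3.9 p. 214] -/
def shimuraCurve_characterGroupHeckeDictionary_disc : Prop :=
  ∀ {N D M p d : ℕ}, p.Prime → D = p * d → IsAdmissibleFactorization N D M →
    ∀ (X : ShimuraCurveData D M) (W : WeierstrassCurve ℚ) [W.IsElliptic], W.conductorNorm ℤ = N →
    ∀ (W' : WeierstrassCurve ℚ) [W'.IsElliptic] (P : ShimuraParametrizationData X W'),
      P.IsMinimalFor W →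
    ∀ (S : Brandt.XiSetup (p * M) d) [Fintype (Brandt.ClassSet S.O)],
      ∃ (Y : Submodule ℤ (Brandt.ClassSet S.O → ℤ)) (pb : ℤ →ₗ[ℤ] Y) (pf : Y →ₗ[ℤ] ℤ)
        (uY : Matrix (Brandt.ClassSet S.O) (Brandt.ClassSet S.O) ℤ) (N₀ : ℤ),
        (∀ (a : ℤ) (y : Y),
            ∑ k, (Brandt.weight S.O k : ℤ) * (pb a : Brandt.ClassSet S.O → ℤ) k *
                (y : Brandt.ClassSet S.O → ℤ) k =
              ((W'.minimalDiscriminantNorm ℤ).factorization p : ℤ) * a * pf y) ∧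
        (∀ a : ℤ, pf (pb a) = (P.deg : ℤ) * a) ∧
        Function.Surjective pf ∧
        (∀ (k : ℤ) (v : Brandt.ClassSet S.O → ℤ), k ≠ 0 → k • v ∈ Y → v ∈ Y) ∧
        (pb 1 : Brandt.ClassSet S.O → ℤ) ∈
          Brandt.eigenLattice (p * M * d) (Brandt.matrix S.O) (fun n => W'.LFunction n) ∧
        (∀ y ∈ Y, ∑ c, y c = 0) ∧
        uY ∈ S.fullHeckeAlgebra ∧ N₀ ≠ 0 ∧ (∀ y ∈ Y, uY *ᵥ y = N₀ • y) ∧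
        (∀ b : Brandt.ClassSet S.O → ℤ, ∑ c, b c = 0 → uY *ᵥ b ∈ Y) ∧
        (∀ C ∈ S.fullHeckeAlgebra, ∀ a : ℤ,
          (∀ (y : Brandt.ClassSet S.O → ℤ) (hy : y ∈ Y),
              (P.deg : ℤ) • (C *ᵥ y) = a • pf ⟨y, hy⟩ • (pb 1 : Brandt.ClassSet S.O → ℤ)) →
          (P.deg : ℤ) ∣ a)

end Literature.NumberTheory.Automorphic

end
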